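import Summits.BirchSwinnertonDyer.BirchSwinnertonDyer.Theorems.ByReductionTypeAtTwoAdditiveShaAnParity
import HarnessLib

/-!
# K4 crux `AdditiveRankZeroAtTwo` (19098), child C2″ `AdditivePotGoodReducibleRestAtTwo` (item 22616): the PARITY DISJUNCT of C2″ is
# EXACTLY a parity statement about `#Ш_an` on the small-torsion classes — an exactness record (seat `bsd-2adic-k4-w2` GEN 3)

Cell `bsd-2adic`, seat `bsd-2adic-k4-w2` GEN 3 (prover, explicit unit, no kit); `--supports stmt-BirchSwinnertonDyer-22616 --as helper`.
HONEST FRAMING (D-0036 / D-0054): bookkeeping theorems about the SHAPE of the child; closes nothing at the `∀`-level; nothing booked; no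
restatement of the executed split is asked (record for the planner); BSD is not proved by any of this.

C2″ reads: on the `E[2]`-REDUCIBLE additive potentially-good non-CM `r_an = 0` curves, `¬ (SMALL ∧ EVEN) → MissingUpperBoundAt W 2`, where
SMALL(W) := «no `ℚ`-isogenous `W'` has `2² ∣ #W'(ℚ)_tors`» and EVEN(W) := «`ord₂ #Ш_an(W)` is even» are the two side conditions of Kato's
member door (addL2x GEN 10 p624850). The hypothesis is a disjunction `¬SMALL ∨ ¬EVEN`; this file separates the two disjuncts:

* (BIG)    `… → ¬ SMALL(W) → MissingUpperBoundAt W 2` — the upper half on the classes WITH a member of `4`-divisible torsion (the census's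
  11 BIGTORS rest classes; the Euler-system content of C2″: Kato's member bound loses `ord₂ #W_K(ℚ)_tors ≥ 2` bits there);
* (PAR)    `… → SMALL(W) → EVEN(W)` — a PARITY statement: on the small-torsion classes `ord₂ #Ш_an` is even (no Selmer group in it at all).

§1 `additivePotGoodReducibleRestAtTwo_of_big_of_parity`: (BIG) ∧ (PAR) ⟹ C2″ (on `SMALL ∧ ¬EVEN` the parity statement makes the case empty).
§2 `big_of_additivePotGoodReducibleRestAtTwo`: C2″ ⟹ (BIG) (verbatim sub-case).
§3 `parity_of_additivePotGoodReducibleRestAtTwo_of_lower`: GRANTED Cassels–Tate (`hCT`) and GZK (`hGZK`), C2″ ∧ C3″ ⟹ (PAR): at a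
   small-torsion curve with `ord₂ #Ш_an` odd, C2″ gives the upper half and C3″ (`AdditivePotGoodLowerHalfAtTwo`, item 22617) the lower half,
   so `BSD₂(W)` holds and `ord₂ #Ш_an = ord₂ #Ш` is even (`AddKatoTwo.even_padicValRat_shaAn_of_bsdp_two` of addL2x GEN 12's `…AdditiveShaAnParity.lean`) — absurd.
§4 `additivePotGoodReducibleRestAtTwo_iff_big_and_parity_of_lower`: GRANTED `hCT`, `hGZK` and C3″: **C2″ ⟺ (BIG) ∧ (PAR)**.
§5 (GEN 3 append) `even_padicValRat_shaAn_iff_of_isIsogenous`, `parity_shaAn_of_isIsogenous`: GRANTED `hCassels`, `hCT`, `hGZK`, `hmod`, the parity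
   of `ord₂ #Ш_an` is an ISOGENY INVARIANT (defects agree by Cassels; `#Ш` is a square on both sides) — (PAR), like SMALL, is a per-class statement.

So, next to the sibling C3″ which the glue needs anyway, the `¬EVEN` disjunct of C2″ carries NO Euler-system content: it is the parity
conjecture (PAR) for `#Ш_an` on the reducible small-torsion classes (a consequence of BSD₂ there, cf. `even_padicValRat_shaAn_of_additiveRankZeroAtTwo`;
0 odd members in the census kits j306106 / j307312), and the research content of C2″ is (BIG) alone. The member door itself is not used here.

References: [SilvermanAEC2009] Thm. X.4.14; [Miller2011LMS] §1, Def. 1.1; [Kato2004Asterisque] Thm. 12.5, §13.13, Prop. 14.16 (2) (the member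
door, context only); [Cassels1965ArithmeticVIII] (context only).
-/

set_option autoImplicit false
-- the Theorems namespace of this sub repeats the summit name by design (D-0017 nested layout)
set_option linter.dupNamespace false

noncomputable section

open scoped Classical

namespace Summit.BirchSwinnertonDyer.BirchSwinnertonDyer.Theorems.AddKatoTwo

open WeierstrassCurve Literature.NumberTheory.EllipticCurves
  Literature.NumberTheory.EllipticCurves.Rank1Residual
  Literature.NumberTheory.EllipticCurves.Rank1Residual.Typed
  Summit.BirchSwinnertonDyer.Rank1Residual
  Summit.BirchSwinnertonDyer.BirchSwinnertonDyer.Theses.ByReductionTypeAtTwo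

/-! ## §1 (BIG) ∧ (PAR) ⟹ C2″ -/

/-- **C2″ from its two disjuncts**: the upper half on the BIG-torsion classes (some isogenous `W'` with `2² ∣ #W'(ℚ)_tors`) together with the
PARITY statement «small class torsion ⟹ `ord₂ #Ш_an` even» give `AdditivePotGoodReducibleRestAtTwo` BY NAME — on a small-torsion curve the
hypothesis `¬ (SMALL ∧ EVEN)` of C2″ contradicts (PAR), so only the BIG case carries content. Pure logic; no arithmetic input.
[cite: Miller2011LMS, §1 and Def. 1.1] -/
theorem additivePotGoodReducibleRestAtTwo_of_big_of_parity
    (hbig : ∀ (W : WeierstrassCurve ℚ) [W.IsElliptic] [W.IsGloballyMinimal], ¬ W.HasCM → W.analyticRank = 0 → Addv W 2 →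
      0 ≤ padicValRat 2 W.j → ¬ W.HasIrreducibleModPGaloisRep 2 →
      (∃ (W' : WeierstrassCurve ℚ) (_ : W'.IsElliptic), IsIsogenous W W' ∧ 2 ^ 2 ∣ W'.torsionOrder) → MissingUpperBoundAt W 2)
    (hpar : ∀ (W : WeierstrassCurve ℚ) [W.IsElliptic] [W.IsGloballyMinimal], ¬ W.HasCM → W.analyticRank = 0 → Addv W 2 →
      0 ≤ padicValRat 2 W.j → ¬ W.HasIrreducibleModPGaloisRep 2 →
      (∀ (W' : WeierstrassCurve ℚ) [W'.IsElliptic], IsIsogenous W W' → ¬ 2 ^ 2 ∣ W'.torsionOrder) →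
      ∀ q : ℚ, shaAn W = (q : ℂ) → Even (padicValRat 2 q)) :
    AdditivePotGoodReducibleRestAtTwo := by
  intro W _ _ hcm hr hadd hj hred hrest
  by_cases hsmall : ∀ (W' : WeierstrassCurve ℚ) [W'.IsElliptic], IsIsogenous W W' → ¬ 2 ^ 2 ∣ W'.torsionOrder
  · exact absurd ⟨hsmall, hpar W hcm hr hadd hj hred hsmall⟩ hrest
  · refine hbig W hcm hr hadd hj hred ?_
    by_contra hnone
    refine hsmall ?_
    intro W' _ hiso hdvd
    exact hnone ⟨W', ‹_›, hiso, hdvd⟩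

/-! ## §2 C2″ ⟹ (BIG) -/

/-- **The BIG-torsion case is a verbatim sub-case of C2″** (a member with `2² ∣ #tors` refutes SMALL, hence `SMALL ∧ EVEN`).
[cite: Miller2011LMS, §1 and Def. 1.1] -/
theorem big_of_additivePotGoodReducibleRestAtTwo (h : AdditivePotGoodReducibleRestAtTwo) :
    ∀ (W : WeierstrassCurve ℚ) [W.IsElliptic] [W.IsGloballyMinimal], ¬ W.HasCM → W.analyticRank = 0 → Addv W 2 →
      0 ≤ padicValRat 2 W.j → ¬ W.HasIrreducibleModPGaloisRep 2 →
      (∃ (W' : WeierstrassCurve ℚ) (_ : W'.IsElliptic), IsIsogenous W W' ∧ 2 ^ 2 ∣ W'.torsionOrder) → MissingUpperBoundAt W 2 := by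
  intro W _ _ hcm hr hadd hj hred hex
  obtain ⟨W', _, hiso, hdvd⟩ := hex
  exact h W hcm hr hadd hj hred (fun hSE => hSE.1 W' hiso hdvd)

/-! ## §3 C2″ ∧ C3″ ⟹ (PAR), granted Cassels–Tate and GZK -/

/-- **Given the lower half C3″, C2″ implies the parity statement (PAR)**: at a reducible small-torsion curve with `#Ш_an = q`, if `ord₂ q`
were odd then `¬ (SMALL ∧ EVEN)` holds, C2″ gives the upper half, C3″ the lower half, hence `BSD₂(W)` (`bsdp_of_missingPPartAt`), and
`ord₂ q = ord₂ #Ш` is even by Cassels–Tate (`even_padicValRat_shaAn_of_bsdp_two`) — contradiction. Conditional on `hCT`, `hGZK` by name.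
[cite: SilvermanAEC2009, Thm. X.4.14] [cite: Miller2011LMS, §1 and Def. 1.1] -/
theorem parity_of_additivePotGoodReducibleRestAtTwo_of_lower (hCT : exists_casselsTate_pairing (K := ℚ))
    (hGZK : rank_eq_analyticRank_of_analyticRank_le_one)
    (h2 : AdditivePotGoodReducibleRestAtTwo) (h3 : AdditivePotGoodLowerHalfAtTwo) :
    ∀ (W : WeierstrassCurve ℚ) [W.IsElliptic] [W.IsGloballyMinimal], ¬ W.HasCM → W.analyticRank = 0 → Addv W 2 →
      0 ≤ padicValRat 2 W.j → ¬ W.HasIrreducibleModPGaloisRep 2 →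
      (∀ (W' : WeierstrassCurve ℚ) [W'.IsElliptic], IsIsogenous W W' → ¬ 2 ^ 2 ∣ W'.torsionOrder) →
      ∀ q : ℚ, shaAn W = (q : ℂ) → Even (padicValRat 2 q) := by
  intro W _ _ hcm hr hadd hj hred hsmall q hq
  haveI : Fact (Nat.Prime 2) := ⟨Nat.prime_two⟩
  by_contra hodd
  have hrest : ¬ ((∀ (W' : WeierstrassCurve ℚ) [W'.IsElliptic], IsIsogenous W W' → ¬ 2 ^ 2 ∣ W'.torsionOrder) ∧
      (∀ q : ℚ, shaAn W = (q : ℂ) → Even (padicValRat 2 q))) := fun hSE => hodd (hSE.2 q hq)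
  have hup : MissingUpperBoundAt W 2 := h2 W hcm hr hadd hj hred hrest
  have hlow : MissingLowerBoundAt W 2 := h3 W hcm hr hadd hj
  have hbsd : BSDp W 2 :=
    bsdp_of_missingPPartAt W 2 hGZK (by rw [hr]; exact zero_le_one) (missingPPartAt_of_lower_of_upper W 2 hlow hup)
  exact hodd (even_padicValRat_shaAn_of_bsdp_two hCT hGZK W hr hbsd hq)

/-! ## §4 C3″ ⟹ (C2″ ⟺ (BIG) ∧ (PAR)), granted Cassels–Tate and GZK -/

/-- **EXACTNESS RECORD: next to the sibling C3″, `AdditivePotGoodReducibleRestAtTwo` is EQUIVALENT to the conjunction of its BIG-torsion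
case and the parity statement (PAR)** (granted Cassels–Tate `hCT` and GZK `hGZK` by name). So the `¬EVEN` disjunct of C2″ carries no
Euler-system content — it is the parity conjecture for `#Ш_an` on the reducible small-torsion classes — and the research content of C2″
is the BIG case. Record for the planner; no restatement asked. [cite: SilvermanAEC2009, Thm. X.4.14] [cite: Miller2011LMS, §1 and Def. 1.1] -/
theorem additivePotGoodReducibleRestAtTwo_iff_big_and_parity_of_lower (hCT : exists_casselsTate_pairing (K := ℚ))
    (hGZK : rank_eq_analyticRank_of_analyticRank_le_one) (h3 : AdditivePotGoodLowerHalfAtTwo) :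
    AdditivePotGoodReducibleRestAtTwo ↔
      ((∀ (W : WeierstrassCurve ℚ) [W.IsElliptic] [W.IsGloballyMinimal], ¬ W.HasCM → W.analyticRank = 0 → Addv W 2 →
          0 ≤ padicValRat 2 W.j → ¬ W.HasIrreducibleModPGaloisRep 2 →
          (∃ (W' : WeierstrassCurve ℚ) (_ : W'.IsElliptic), IsIsogenous W W' ∧ 2 ^ 2 ∣ W'.torsionOrder) → MissingUpperBoundAt W 2) ∧
        (∀ (W : WeierstrassCurve ℚ) [W.IsElliptic] [W.IsGloballyMinimal], ¬ W.HasCM → W.analyticRank = 0 → Addv W 2 →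
          0 ≤ padicValRat 2 W.j → ¬ W.HasIrreducibleModPGaloisRep 2 →
          (∀ (W' : WeierstrassCurve ℚ) [W'.IsElliptic], IsIsogenous W W' → ¬ 2 ^ 2 ∣ W'.torsionOrder) →
          ∀ q : ℚ, shaAn W = (q : ℂ) → Even (padicValRat 2 q))) :=
  ⟨fun h2 => ⟨big_of_additivePotGoodReducibleRestAtTwo h2, parity_of_additivePotGoodReducibleRestAtTwo_of_lower hCT hGZK h2 h3⟩,
    fun h => additivePotGoodReducibleRestAtTwo_of_big_of_parity h.1 h.2⟩

/-! ## §5 (PAR) is a statement about ISOGENY CLASSES: the parity of `ord₂ #Ш_an` is a class invariant -/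

/-- **The parity of `ord₂ #Ш_an` is an isogeny invariant** (appended by seat `bsd-2adic-k4-w2` GEN 3): for `ℚ`-isogenous globally minimal `W ∼ W'`
of analytic rank `≤ 1` with `#Ш_an(W) = q`, `#Ш_an(W') = q'`, GRANTED Cassels' invariance of the BSD quotient (`hCassels`), Cassels–Tate (`hCT`), GZK
(`hGZK`) and modularity (`hmod`): `ord₂ q` is even iff `ord₂ q'` is — the defects `ord₂ #Ш_an − ord₂ #Ш` agree (`TwistComparison.defectAgreeAt_of_isIsogenous`)
and both `#Ш` are squares. So the side condition EVEN of C2″, like SMALL, depends only on the isogeny class, and (PAR) is a per-CLASS statement.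
[cite: Cassels1965ArithmeticVIII, Thm. 1.3] [cite: SilvermanAEC2009, Thm. X.4.14] [cite: Miller2011LMS, Def. 1.1] -/
theorem even_padicValRat_shaAn_iff_of_isIsogenous (hCT : exists_casselsTate_pairing (K := ℚ))
    (hCassels : bsdRHS_eq_of_isIsogenous) (hGZK : rank_eq_analyticRank_of_analyticRank_le_one) (hmod : hasEntireLFunction_rat)
    {W W' : WeierstrassCurve ℚ} [W.IsElliptic] [W.IsGloballyMinimal] [W'.IsElliptic] [W'.IsGloballyMinimal]
    (hiso : IsIsogenous W W') (hr : W.analyticRank ≤ 1)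
    {q q' : ℚ} (hq : shaAn W = (q : ℂ)) (hq' : shaAn W' = (q' : ℂ)) :
    Even (padicValRat 2 q) ↔ Even (padicValRat 2 q') := by
  haveI : Fact (Nat.Prime 2) := ⟨Nat.prime_two⟩
  have hfin : W.ShaFinite := (hGZK W hr).2
  obtain ⟨hfin', -⟩ := hCassels W W' hiso hfin
  obtain ⟨r, r', hr0, hr', hδ⟩ := Summit.BirchSwinnertonDyer.Rank1Residual.Additive.TwistComparison.defectAgreeAt_of_isIsogenous W W' 2 hCassels hmod hiso hfin hq
  have hrq : r = q := by exact_mod_cast hr0.symm.trans hq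
  have hrq' : r' = q' := by exact_mod_cast hr'.symm.trans hq'
  subst hrq hrq'
  haveI : Finite W.sha := hfin
  haveI : Finite W'.sha := hfin'
  obtain ⟨a, ha⟩ := O6.even_padicValNat_of_isSquare (p := 2) (isSquare_shaOrder_of_casselsTate hCT W hfin) (W.shaOrder_pos hfin).ne'
  obtain ⟨b, hb⟩ := O6.even_padicValNat_of_isSquare (p := 2) (isSquare_shaOrder_of_casselsTate hCT W' hfin') (W'.shaOrder_pos hfin').ne'
  rw [ha, hb] at hδ
  push_cast at hδ
  constructor
  · rintro ⟨c, hc⟩; exact ⟨c - a + b, by omega⟩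
  · rintro ⟨c, hc⟩; exact ⟨c - b + a, by omega⟩

/-- **(PAR) transports along isogenies**: if every `#Ш_an`-value of `W'` has even `ord₂` then so does every `#Ш_an`-value of an isogenous `W`
(analytic rank `≤ 1`; `hCassels`, `hCT`, `hGZK`, `hmod` by name). Bookkeeping for the planner: (PAR) may be checked at ANY member of a class
(e.g. the census representative). [cite: Cassels1965ArithmeticVIII, Thm. 1.3] [cite: SilvermanAEC2009, Thm. X.4.14] -/
theorem parity_shaAn_of_isIsogenous (hCT : exists_casselsTate_pairing (K := ℚ))
    (hCassels : bsdRHS_eq_of_isIsogenous) (hGZK : rank_eq_analyticRank_of_analyticRank_le_one) (hmod : hasEntireLFunction_rat)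
    {W W' : WeierstrassCurve ℚ} [W.IsElliptic] [W.IsGloballyMinimal] [W'.IsElliptic] [W'.IsGloballyMinimal]
    (hiso : IsIsogenous W W') (hr : W.analyticRank ≤ 1)
    (h' : ∀ q' : ℚ, shaAn W' = (q' : ℂ) → Even (padicValRat 2 q')) :
    ∀ q : ℚ, shaAn W = (q : ℂ) → Even (padicValRat 2 q) := by
  intro q hq
  have hfin : W.ShaFinite := (hGZK W hr).2
  obtain ⟨r, r', -, hr', -⟩ := Summit.BirchSwinnertonDyer.Rank1Residual.Additive.TwistComparison.defectAgreeAt_of_isIsogenous W W' 2 hCassels hmod hiso hfin hq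
  exact (even_padicValRat_shaAn_iff_of_isIsogenous hCT hCassels hGZK hmod hiso hr hq hr').mpr (h' r' hr')

end Summit.BirchSwinnertonDyer.BirchSwinnertonDyer.Theorems.AddKatoTwo

end
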